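import Summits.MatrixMultiplication.OmegaCensus.ParityWindowLemma
import Summits.MatrixMultiplication.OmegaCensus.NearTilingPeriodic
import HarnessLib

/-!
# A `c₀`-periodic injective box `{s, s+d} + {t, t+e} + W` forces the window parity of `W`'s coset counts

ω-census `pub-omega`, family (b3), seat pub-omega-group gen 11.  Framing: lottery ticket; floor = certified bounds/negative
ranges.  VALUE: a kernel lemma for the structure theory of TPP triples in dicyclic-type groups (step 2 of the stability
statement (H) for the shape class N3, `pub-omega-group-g11/FAMILY-B-ADDENDUM-g11.md` §6); NOT progress on ω.

Let `π : A →+ B` have kernel `{0, c₀}` (`c₀ ≠ 0`), `X = {s, s+d}`, `Y = {t, t+e}` genuine two-element sets, `W ⊆ A`, and let the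
box `X + Y + W` be injective (as in every TPP triple of a dihedral-like group, `sum_injOn'`) and `c₀`-periodic (as at every
exact vertex, `periodic_of_exact_vertex`).  For `z ∈ B` put `M(z) = #{w ∈ W : π w = z}`.

* `window_parity_of_periodic_box`: `M(z) + M(z − πd) + M(z − πe) + M(z − πd − πe)` is even for every `z`
  (each `π`-fibre of a periodic set is `c₀`-invariant, hence even; by injectivity it is the disjoint union of the four
  translates' fibres).
* `pair_diff_trichotomy_of_periodic_box`: if moreover `|W|` is odd and `B` is a `2`-group (`2^m · B = 0`), then
  `π d = 0 ∨ π e = 0 ∨ (π d = π e ∧ 2·π d = 0)` (`window_lemma` of `ParityWindowLemma.lean` applied to `M mod 2`).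
* `stable_pair_of_trichotomy`: the four trichotomies together with the box-injectivity conditions `dᵢ ≠ ±eⱼ` force
  `d₀ = d₁ ∈ A[2]` or `e₀ = e₁ ∈ A[2]`, i.e. `S` or `T` is stable under a central involution — the hypothesis of
  `no_dicyclic_law_of_stable_member` (`DicyclicLawReduction.lean`).
In an N3-class dicyclic-law triple (`(2,2),(2,2),(u,u+1)`, all eight boxes periodic) the trichotomy holds for each of the
four pairs (`Sᵢ`-difference, `Tⱼ`-difference) with `W` the odd-size part of `U`; so, when `A/⟨c₀⟩` is a `2`-group mapping onto
`𝔽₂³` (e.g. `C₂² × Q_{4^{j+1}}`), NO N3-class triple attains the dicyclic law — what remains for the kernel is the vertex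
bookkeeping (exact vertices ⇒ periodic boxes, `periodic_of_exact_vertex`).
-/

namespace Summit.MatrixMultiplication.OmegaCensus

open Finset

section PeriodicBox

variable {A : Type} [AddCommGroup A] [Fintype A] [DecidableEq A] {B : Type} [AddCommGroup B] [Fintype B]
  [DecidableEq B]

omit [Fintype A] [Fintype B] in
/-- A `π`-fibre count of a `c₀`-periodic set is even (`π c₀ = 0`, `c₀ ≠ 0`, `2c₀ = 0`). [folklore] -/
theorem even_card_fibre_of_periodic (π : A →+ B) {c₀ : A} (hπc : π c₀ = 0) (hc₀ : c₀ ≠ 0) (h2c : c₀ + c₀ = 0)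
    {E : Finset A} (hper : E.image (· + c₀) = E) (y : B) : 2 ∣ (E.filter fun a => π a = y).card := by
  apply card_even_of_periodic (c₀ := c₀) _ hc₀ h2c
  apply eq_of_subset_of_card_le _ (by rw [card_image_of_injective _ (add_left_injective c₀)])
  intro x hx
  obtain ⟨a, ha, rfl⟩ := mem_image.1 hx
  obtain ⟨haE, hay⟩ := mem_filter.1 ha
  refine mem_filter.2 ⟨?_, by rw [map_add, hπc, add_zero, hay]⟩
  rw [← hper]; exact mem_image_of_mem _ haE

omit [Fintype A] [Fintype B] in
/-- The fibre count of an injective box `X + Y + W` over `y` is the sum over `X × Y` of the fibre counts of `W`.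
[folklore] -/
theorem card_fibre_box_eq_sum (π : A →+ B) {X Y W : Finset A}
    (hinj : Set.InjOn (fun p : A × A × A => p.1 + p.2.1 + p.2.2) ↑(X ×ˢ Y ×ˢ W)) (y : B) :
    (((X ×ˢ Y ×ˢ W).image fun p : A × A × A => p.1 + p.2.1 + p.2.2).filter fun a => π a = y).card =
      ∑ x ∈ X, ∑ x' ∈ Y, (W.filter fun w => π w = y - π x - π x').card := by
  rw [filter_image, card_image_of_injOn (hinj.mono (coe_subset.2 (filter_subset _ _))), card_filter, sum_product]
  refine sum_congr rfl fun x _ => ?_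
  rw [sum_product]
  refine sum_congr rfl fun x' _ => ?_
  rw [← card_filter]
  congr 1
  apply filter_congr
  intro w _
  simp only [map_add]
  constructor <;> intro h
  · rw [← h]; abel
  · rw [h]; abel

omit [Fintype A] [Fintype B] in
/-- **Window parity.**  `π : A →+ B` with kernel `{0, c₀}`, `c₀ ≠ 0`; an injective, `c₀`-periodic box
`{s, s+d} + {t, t+e} + W` with `d, e ≠ 0`; then for every `z`,
`M(z) + M(z − πd) + M(z − πe) + M(z − πd − πe) ≡ 0 (mod 2)`, `M(z) = #{w ∈ W : π w = z}`. [folklore] -/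
theorem window_parity_of_periodic_box (π : A →+ B) {c₀ : A} (hker : ∀ a : A, π a = 0 ↔ a = 0 ∨ a = c₀) (hc₀ : c₀ ≠ 0)
    {s d t e : A} {W : Finset A} (hd : d ≠ 0) (he : e ≠ 0)
    (hinj : Set.InjOn (fun p : A × A × A => p.1 + p.2.1 + p.2.2) ↑(({s, s + d} : Finset A) ×ˢ ({t, t + e} : Finset A) ×ˢ W))
    (hper : ((({s, s + d} : Finset A) ×ˢ ({t, t + e} : Finset A) ×ˢ W).image
      fun p : A × A × A => p.1 + p.2.1 + p.2.2).image (· + c₀) =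
      (({s, s + d} : Finset A) ×ˢ ({t, t + e} : Finset A) ×ˢ W).image fun p : A × A × A => p.1 + p.2.1 + p.2.2)
    (z : B) :
    ((W.filter fun w => π w = z).card : ZMod 2) + ((W.filter fun w => π w = z + -π d).card : ZMod 2) +
      ((W.filter fun w => π w = z + -π e).card : ZMod 2) + ((W.filter fun w => π w = z + -π d + -π e).card : ZMod 2) = 0 := by
  have hπc : π c₀ = 0 := (hker c₀).2 (Or.inr rfl)
  have h2c : c₀ + c₀ = 0 := by
    rcases (hker (c₀ + c₀)).1 (by rw [map_add, hπc, add_zero]) with h | h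
    · exact h
    · exact absurd (add_eq_left.1 h) hc₀
  have hsd : s ≠ s + d := fun h => hd (left_eq_add.1 h)
  have hte : t ≠ t + e := fun h => he (left_eq_add.1 h)
  -- evenness of the fibre over `y = z + π s + π t`, expanded as a sum over `X × Y`
  have hev := even_card_fibre_of_periodic π hπc hc₀ h2c hper (z + π s + π t)
  rw [card_fibre_box_eq_sum π hinj, sum_pair hsd, sum_pair hte, sum_pair hte] at hev
  simp only [map_add] at hev
  have e1 : z + π s + π t - π s - π t = z := by abel
  have e2 : z + π s + π t - π s - (π t + π e) = z + -π e := by abel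
  have e3 : z + π s + π t - (π s + π d) - π t = z + -π d := by abel
  have e4 : z + π s + π t - (π s + π d) - (π t + π e) = z + -π d + -π e := by abel
  rw [e1, e2, e3, e4] at hev
  have hcast : (((W.filter fun w => π w = z).card + (W.filter fun w => π w = z + -π e).card +
      ((W.filter fun w => π w = z + -π d).card + (W.filter fun w => π w = z + -π d + -π e).card) : ℕ) : ZMod 2) = 0 :=
    (ZMod.natCast_eq_zero_iff _ 2).2 hev
  push_cast at hcast
  linear_combination hcast

omit [Fintype A] in
/-- **Trichotomy for the pair of differences.**  In the situation of `window_parity_of_periodic_box`, if `|W|` is odd and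
`B` is a `2`-group (`2^m · B = 0`), then `π d = 0`, or `π e = 0`, or `π d = π e` with `2 π d = 0`. [folklore] -/
theorem pair_diff_trichotomy_of_periodic_box (π : A →+ B) {c₀ : A} (hker : ∀ a : A, π a = 0 ↔ a = 0 ∨ a = c₀)
    (hc₀ : c₀ ≠ 0) {m : ℕ} (hB : ∀ b : B, (2 ^ m) • b = 0)
    {s d t e : A} {W : Finset A} (hd : d ≠ 0) (he : e ≠ 0) (hW : Odd W.card)
    (hinj : Set.InjOn (fun p : A × A × A => p.1 + p.2.1 + p.2.2) ↑(({s, s + d} : Finset A) ×ˢ ({t, t + e} : Finset A) ×ˢ W))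
    (hper : ((({s, s + d} : Finset A) ×ˢ ({t, t + e} : Finset A) ×ˢ W).image
      fun p : A × A × A => p.1 + p.2.1 + p.2.2).image (· + c₀) =
      (({s, s + d} : Finset A) ×ˢ ({t, t + e} : Finset A) ×ˢ W).image fun p : A × A × A => p.1 + p.2.1 + p.2.2) :
    π d = 0 ∨ π e = 0 ∨ (π d = π e ∧ π d + π d = 0) := by
  -- the parity function of the fibre counts of `W` has odd weight
  set f : B → ZMod 2 := fun z => ((W.filter fun w => π w = z).card : ZMod 2) with hf
  have hsum : ∑ z : B, f z = 1 := by
    have hnat : ∑ z : B, (W.filter fun w => π w = z).card = W.card :=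
      (card_eq_sum_card_fiberwise (f := π) (s := W) (t := univ) fun w _ => mem_univ _).symm
    have : ((∑ z : B, (W.filter fun w => π w = z).card : ℕ) : ZMod 2) = (W.card : ZMod 2) := by rw [hnat]
    push_cast at this
    rw [hf]
    rw [this]
    obtain ⟨k, hk⟩ := hW
    rw [hk]; push_cast
    rw [show (2 : ZMod 2) = 0 from rfl, zero_mul, zero_add]
  have hw : ∀ z : B, f z + f (z + -π d) + f (z + -π e) + f (z + -π d + -π e) = 0 := fun z =>
    window_parity_of_periodic_box π hker hc₀ hd he hinj hper z
  rcases window_lemma hB f hsum (-π d) (-π e) hw with h | h | ⟨h1, h2⟩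
  · exact Or.inl (neg_eq_zero.1 h)
  · exact Or.inr (Or.inl (neg_eq_zero.1 h))
  · refine Or.inr (Or.inr ⟨neg_injective h1, ?_⟩)
    have := congrArg Neg.neg h2
    rwa [neg_add, neg_neg, neg_zero] at this

/-! ## From the trichotomy to a stable pair -/

omit [Fintype A] [Fintype B] [DecidableEq A] [DecidableEq B] in
/-- Core case: `π d ≠ 0 ≠ π e`. [folklore] -/
theorem stable_pair_core (π : A →+ B) {c₀ : A} (hker : ∀ a : A, π a = 0 ↔ a = 0 ∨ a = c₀) (hc₀ : c₀ ≠ 0)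
    {d d' e e' : A} (hd'0 : d' ≠ 0) (he'0 : e' ≠ 0) (hπd : π d ≠ 0) (hπe : π e ≠ 0)
    (h_de : π d = 0 ∨ π e = 0 ∨ (π d = π e ∧ π d + π d = 0))
    (h_d'e : π d' = 0 ∨ π e = 0 ∨ (π d' = π e ∧ π d' + π d' = 0))
    (h_de' : π d = 0 ∨ π e' = 0 ∨ (π d = π e' ∧ π d + π d = 0))
    (n_de : d ≠ e ∧ d ≠ -e) (n_d'e : d' ≠ e ∧ d' ≠ -e) (n_de' : d ≠ e' ∧ d ≠ -e') (n_d'e' : d' ≠ e' ∧ d' ≠ -e') :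
    (d = d' ∧ d + d = 0) ∨ (e = e' ∧ e + e = 0) := by
  have hπc : π c₀ = 0 := (hker c₀).2 (Or.inr rfl)
  have h2c : c₀ + c₀ = 0 := by
    rcases (hker (c₀ + c₀)).1 (by rw [map_add, hπc, add_zero]) with h | h
    · exact h
    · exact absurd (add_eq_left.1 h) hc₀
  have hk : ∀ x : A, x ≠ 0 → π x = 0 → x = c₀ := fun x hx h => ((hker x).1 h).resolve_left hx
  -- `π x = π y ⟹ x = y ∨ x = y + c₀`
  have hfib : ∀ x y : A, π x = π y → x = y ∨ x = y + c₀ := by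
    intro x y h
    rcases (hker (x - y)).1 (by rw [map_sub, h, sub_self]) with h' | h'
    · exact Or.inl (sub_eq_zero.1 h')
    · exact Or.inr (by rw [← h', add_sub_cancel])
  obtain ⟨hγ, h2⟩ : π d = π e ∧ π d + π d = 0 := by
    rcases h_de with h | h | h
    · exact absurd h hπd
    · exact absurd h hπe
    · exact h
  -- `e = d + c₀`
  have he : e = d + c₀ := by
    rcases hfib e d hγ.symm with h | h
    · exact absurd h.symm n_de.1
    · exact h
  -- `2d = 0` (if `2d = c₀` then `e = d + c₀ = -d`)
  have h2d : d + d = 0 := by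
    rcases (hker (d + d)).1 (by rw [map_add, h2]) with h | h
    · exact h
    · exfalso; apply n_de.2
      -- `d = -e`: `d + e = d + d + c₀ = c₀ + c₀ = 0`
      have : d + e = 0 := by rw [he, ← add_assoc, h, h2c]
      exact eq_neg_of_add_eq_zero_left this
  -- the second `S`-difference
  rcases h_d'e with h | h | ⟨h, -⟩
  · -- `d' = c₀`; then `e' = d + c₀ = e`
    have hd' : d' = c₀ := hk d' hd'0 h
    rcases h_de' with h' | h' | ⟨h', -⟩
    · exact absurd h' hπd
    · exact absurd (hd'.trans (hk e' he'0 h').symm) n_d'e'.1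
    · rcases hfib e' d h'.symm with h'' | h''
      · exact absurd h''.symm n_de'.1
      · right
        refine ⟨by rw [he, h''], ?_⟩
        rw [he, add_add_add_comm, h2d, h2c, add_zero]
  · exact absurd h hπe
  · -- `π d' = π e = π d`: `d' ∈ {d, d + c₀ = e}`
    rw [← hγ] at h
    rcases hfib d' d h with h' | h'
    · exact Or.inl ⟨h'.symm, h2d⟩
    · exact absurd (h'.trans he.symm) n_d'e.1

omit [Fintype A] [Fintype B] [DecidableEq A] [DecidableEq B] in
/-- **Stable pair from the trichotomy.**  `π : A →+ B` with kernel `{0, c₀}` (`c₀ ≠ 0`); nonzero differences `d₀, d₁`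
(parts of `S`) and `e₀, e₁` (parts of `T`) with the box-injectivity conditions `dᵢ ≠ ±eⱼ` and, for every `(i,j)`, the
conclusion of `pair_diff_trichotomy_of_periodic_box`.  Then `d₀ = d₁` with `2d₀ = 0` (so `S` is `ρ(d₀)`-stable) or
`e₀ = e₁` with `2e₀ = 0` (`T` is `ρ(e₀)`-stable). [folklore] -/
theorem stable_pair_of_trichotomy (π : A →+ B) {c₀ : A} (hker : ∀ a : A, π a = 0 ↔ a = 0 ∨ a = c₀) (hc₀ : c₀ ≠ 0)
    {d₀ d₁ e₀ e₁ : A} (hd₀ : d₀ ≠ 0) (hd₁ : d₁ ≠ 0) (he₀ : e₀ ≠ 0) (he₁ : e₁ ≠ 0)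
    (h00 : π d₀ = 0 ∨ π e₀ = 0 ∨ (π d₀ = π e₀ ∧ π d₀ + π d₀ = 0))
    (h01 : π d₀ = 0 ∨ π e₁ = 0 ∨ (π d₀ = π e₁ ∧ π d₀ + π d₀ = 0))
    (h10 : π d₁ = 0 ∨ π e₀ = 0 ∨ (π d₁ = π e₀ ∧ π d₁ + π d₁ = 0))
    (h11 : π d₁ = 0 ∨ π e₁ = 0 ∨ (π d₁ = π e₁ ∧ π d₁ + π d₁ = 0))
    (n00 : d₀ ≠ e₀ ∧ d₀ ≠ -e₀) (n01 : d₀ ≠ e₁ ∧ d₀ ≠ -e₁) (n10 : d₁ ≠ e₀ ∧ d₁ ≠ -e₀) (n11 : d₁ ≠ e₁ ∧ d₁ ≠ -e₁) :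
    (d₀ = d₁ ∧ d₀ + d₀ = 0) ∨ (e₀ = e₁ ∧ e₀ + e₀ = 0) := by
  have hπc : π c₀ = 0 := (hker c₀).2 (Or.inr rfl)
  have h2c : c₀ + c₀ = 0 := by
    rcases (hker (c₀ + c₀)).1 (by rw [map_add, hπc, add_zero]) with h | h
    · exact h
    · exact absurd (add_eq_left.1 h) hc₀
  have hk : ∀ x : A, x ≠ 0 → π x = 0 → x = c₀ := fun x hx h => ((hker x).1 h).resolve_left hx
  by_cases hD₀ : π d₀ = 0
  · by_cases hD₁ : π d₁ = 0
    · left; rw [hk d₀ hd₀ hD₀, hk d₁ hd₁ hD₁]; exact ⟨rfl, h2c⟩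
    by_cases hE₀ : π e₀ = 0
    · by_cases hE₁ : π e₁ = 0
      · right; rw [hk e₀ he₀ hE₀, hk e₁ he₁ hE₁]; exact ⟨rfl, h2c⟩
      -- roles: d = d₁, d' = d₀, e = e₁, e' = e₀
      rcases stable_pair_core π hker hc₀ hd₀ he₀ hD₁ hE₁ h11 h01 h10 n11 n01 n10 n00 with ⟨h, h'⟩ | ⟨h, h'⟩
      · exact Or.inl ⟨h.symm, by rw [← h]; exact h'⟩
      · exact Or.inr ⟨h.symm, by rw [← h]; exact h'⟩
    -- d = d₁, d' = d₀, e = e₀, e' = e₁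
    rcases stable_pair_core π hker hc₀ hd₀ he₁ hD₁ hE₀ h10 h00 h11 n10 n00 n11 n01 with ⟨h, h'⟩ | h
    · exact Or.inl ⟨h.symm, by rw [← h]; exact h'⟩
    · exact Or.inr h
  by_cases hE₀ : π e₀ = 0
  · by_cases hE₁ : π e₁ = 0
    · right; rw [hk e₀ he₀ hE₀, hk e₁ he₁ hE₁]; exact ⟨rfl, h2c⟩
    -- d = d₀, d' = d₁, e = e₁, e' = e₀
    rcases stable_pair_core π hker hc₀ hd₁ he₀ hD₀ hE₁ h01 h11 h00 n01 n11 n00 n10 with h | ⟨h, h'⟩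
    · exact Or.inl h
    · exact Or.inr ⟨h.symm, by rw [← h]; exact h'⟩
  -- d = d₀, d' = d₁, e = e₀, e' = e₁
  exact stable_pair_core π hker hc₀ hd₁ he₁ hD₀ hE₀ h00 h10 h01 n00 n10 n01 n11

end PeriodicBox

end Summit.MatrixMultiplication.OmegaCensus
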